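import Mathlib
import HarnessLib
import HarnessLib.Audit
import Summits.QuantumAdvantage.Statement
import Literature.Computability.Cryptography.ClassBQP
import Literature.Computability.Complexity.Randomized
import Summits.QuantumAdvantage.QuantumAdvantage.Theorems.LinnikCubicClassGroupsBitwiseSearchToDecision
import Summits.QuantumAdvantage.QuantumAdvantage.Theorems.LinnikCubicClassGroupsDegreeOnePrimesEscapeProof
import Literature.NumberTheory.LFunctions.DedekindZeta
import HarnessLib.Audit.Status.Attr

/-!
Route: ThirdFactorialPincer

DORMANT since 2026-08-26T15:41:24Z (reconciler: no traction for 6.5 d (last activity item-evidence-added at 2026-08-20T02:36:12Z); parked, not closed — `ledger route dormant route-QuantumAdvantage-ThirdFactorialPincer --off` to reactiva) — unstaffed, not closed; items shared with open routes are served there. `ledger route dormant <id> --off` reactivates.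

# Route ThirdFactorialPincer — the third Gauss factorial ((p-1)/3)! mod p is quantum polynomial-time
- ideal from class groups (Mazur-Wiles), unit from the Kummer sector, digit = the factorial

X (hypothesis-type, realises card third-factorial-pincer-v2) = GaussFactorialHard: no probabilistic
polynomial-time algorithm
outputs, on every input x with p := decodeNat x prime and p ≡ 4 or 7 (mod 9), the |x| low bits of
the GAUSS FACTORIAL
((p−1)/3)! mod p (the third-factorial bit-function f; f := 0 off those p). It suffices to show X,
because the route's earned half
is a THEOREM-TARGET WITH NO UNPROVED ARITHMETIC HYPOTHESIS (route-repair 2026-08-16: the former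
conditional_on ERH is gone): f ∈ FBQP,
by a PINCER on the Eisenstein integer S_p := Σ_{0<j<p/3} χ_p(j) ∈ ℤ[ω] — its IDEAL from the class
groups of the abelian sextic field
F_p = K_p(ω) of conductor 3p and of the cyclic cubic K_p, read through Mazur–Wiles (θ-parts of
Cl(F_p)[ℓ^∞] have order the λ-part of
B_{1,θ̄}; N(S_p) = h(F_p)/h(K_p)), crux IdealLegOfEscape, where the class groups are generated
WITHOUT GRH by O(log p) random
degree-one primes of norm ≤ p^C — the Linnik–Stark escape counts SexticEscapeCount (crux; ζ_{F_p} is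
a product of Dirichlet
L-functions whose only real character is χ₋₃, so Thorner–Zaman's exceptional character is a
NONTRIVIAL genus character and half the
classes stay bright) and DegreeOnePrimesEscape (crux, shared with route LinnikCubicClassGroups; K_p
has no quadratic subfield); its
UNIT from the argument arg S_p = arg G(χ_p) + arg L(1, χ̄_pψ₃) + const (Kummer's sector by van
Dam–Seroussi phase estimation, L(1) by
classical Monte-Carlo to 1/log²p), crux ArgLeg; and then its (1−ω)-adic DIGIT, which IS the cubic
class of ((p−1)/3)! (support
DigitCongruence), combined with Jacobi's (K!)³ ≡ (−1)^K/L (support JacobiCube) gives the factorial: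
crux FactorialFromPincer (IdealLeg → ArgLeg → f ∈ FBQP,
whose finer glue ThirdFactorialGlue + the two congruences are kept as provable supports). With f ∈
FBQP and the bitwise
search-to-decision lemma (crux BitwiseSearchToDecision, shared with LinnikCubicClassGroups), BQP ⊆
BPP would give a PPT algorithm for f,
contradicting X; hence ∃ L ∈ BQP ∖ BPP. (Badge repair 2026-08-16: `closes` rests on crux-badged
items only.)
Lean: `¬ ∃ A : Literature.Computability.Complexity.RandAlg (List Bool) (List Bool), A.IsPolyTime id
id ∧ ∀ x : List Bool, (2 : ℝ) / 3 ≤ A.pr id x {List.ofFn (fun i : Fin x.length => (if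
(Computability.decodeNat x).Prime ∧ (Computability.decodeNat x % 9 = 4 ∨ Computability.decodeNat x %
9 = 7) then Nat.factorial ((Computability.decodeNat x - 1) / 3) % Computability.decodeNat x else
0).testBit i.val)}`

## Assembly
Pure logic (sorry-free in Sketch.lean and glue.lean; axioms propext/choice/Quot.sound):
FactorialFromPincer applied to
IdealLegOfEscape DegreeOnePrimesEscape SexticEscapeCount (definitionally IdealLeg) and ArgLeg puts f
in FBQP; if QuantumAdvantage failed
then BQP ⊆ BPP (classically), and BitwiseSearchToDecision (output length |x|, polynomial X) yields a
PPT algorithm for f, contradicting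
GaussFactorialHard. Deciding theorem: `closes (hX : GaussFactorialHard) (hI : IdealLegOfEscape) (hA
: ArgLeg) (hE6 : SexticEscapeCount)
(hE3 : DegreeOnePrimesEscape) (hF : FactorialFromPincer) (hS : BitwiseSearchToDecision) :
_root_.QuantumAdvantage` — every hypothesis
crux-badged. IdealLeg, ThirdFactorialGlue, DigitCongruence, JacobiCube (the foreseen split of
FactorialFromPincer), NormIsRelClassNumber,
PadLemma and GaussFactorialClassical (the kill) are supports, deliberately not hypotheses.

CONDITIONAL on Literature.NumberTheory.LFunctions.ExtendedRiemannHypothesis — this route is an explicit reduction to that named conjecture (D-0019: crux floor waived).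

Rationale: WHY THIS LINE. Every witness route to S is conditional on a classical-hardness hypothesis; this one
takes the oldest √p wall in arithmetic — n! mod p
(Strassen; BostanGaudrySchost2007 p^{1/2+o(1)}; Tal2026ModularFactorials breaks 1/2 QUANTUMLY only
under a divisor promise and still pays √(p/q) for the Gauss factorial) — and earns a theorem-grade
quantum half at the Gauss-factorial point N = 3 WITH NO UNPROVED ARITHMETIC HYPOTHESIS (route-repair
2026-08-16: the former conditional_on ERH, used only for Bach1990 generation, is replaced by two
Linnik–Stark escape counts). The mechanism is a pincer on ONE algebraic
integer: S_p = −χ̄(3)B_{1,χψ₃}/2 (SzmidtUrbanowiczZagier1995, UrbanowiczWilliams2000), whose NORM is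
the relative class number h⁻(F_p)
(Washington1997 Thm 4.17), whose prime IDEAL factorisation is the Galois-module structure of
Cl(F_p)⁻ (MazurWiles1984, Gras conjecture, ℓ ∤ 6 —
exactly the split primes of ℤ[ω]), whose UNIT is Kummer's sector of the cubic Gauss sum shifted by
arg L(1,θ̄) (vanDamSeroussi2002 Thm 1;
Landau's |L(1,χ)| ≫ 1/log q for complex χ, MontgomeryVaughan2007 §11), and whose λ-adic DIGIT is
χ_p(((p−1)/3)!) (Stickelberger's leading term
/ GrossKoblitz1979; Jacobi's binomial theorem, BerndtEvans1981, IrelandRosen1990 Ch. 9). The class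
groups of F_p = K_p(ω) and K_p are
generated by O(log p) RANDOM degree-one primes of norm ≤ p^C, GRH-free (mechanism of card
linnik-lights-the-class-group-v2 / route LinnikCubicClassGroups): ThornerZaman2019 Thm 1.4 (READ
arXiv:1803.02823 pp. 2–3: K-uniform Chebotarev for the Hilbert class field, x ≥ (D_K n^n)^{c₁}, main
term (1/h)(Li x − χ₁(C) Li x^{β₁}), at most one real exceptional χ₁) — and N = 3 is exactly the
lucky order: the characters of F_p are χ_p^a ψ₃^b with χ_p cubic, so the ONLY real Dirichlet
character in ζ_{F_p} =
ζ·L(ψ₃)·L(χ_p)L(χ̄_p)·L(χ_pψ₃)L(χ̄_pψ₃) is ψ₃ = χ₋₃ (conductor 3, L(σ,χ₋₃) > 0 on (0,1)); complex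
characters have no real exceptional
zeros (Kadiri2005 explicit region ⊃ TZ's 1 − 1/(8 log(27p⁴6⁶))), hence ζ_{F_p} has NO Landau–Siegel
zero, χ₁ (if any) is a NONTRIVIAL
genus character, and the half of Cl(F_p) outside ker χ₁ is ENHANCED, not depleted: every proper
subgroup misses ≥ h/4 bright classes
(SexticEscapeCount); K_p is cyclic cubic with no quadratic subfield (DegreeOnePrimesEscape at n = 3,
Stark). For N = 4 the field contains the
Legendre character mod p and a genuine Siegel-zero issue returns — the third factorial is the
unconditional sweet spot. Imported areas: Iwasawa theory of abelian fields (Mazur–Wiles used INSIDE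
an algorithm), Gauss sums, K-uniform Chebotarev (ThornerZaman2019, Weiss1983), quantum HSP
class-group algorithms over an arbitrary generating set (Hallgren2005, BiasseSong2015,
doi:10.1145/2591796.2591860), Gauss-sum phase estimation. What it does that prior routes do not:
KummerSector (broken) decides only the sector, no factorial; CentralFactorial is orders 2/4 and
carries GRH; DarkClassGroups / LinnikCubicClassGroups compute class NUMBERS (imaginary quadratic
under no-Siegel / pure cubic, escape crux shared here); Tal 2026 pincers the JACOBI sum (known
Stickelberger ideal, hard generator in ℚ(ζ_q)) — here the field is tiny (ℤ[ω], Euclid) and the IDEAL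
is the unknown, supplied by class groups: the pincer one level up, resolving the μ₃-ambiguity Tal
pays √p for.

RANKED CRUXES. #0 GaussFactorialHard (target; auto-badged crux by the gate as a hypothesis of
`closes`, hypothesis-type, never staffed for proof) — X — no PPT algorithm outputs with probability
≥ 2/3, on every x, the |x| low bits of ((p−1)/3)! mod p for p = decodeNat x prime, p ≡ 4, 7 (mod 9)
(0 otherwise). Hypothesis-type (card K2); its negation GaussFactorialClassical is filed as the kill;
route-repair: `IsPPT A id` spelled `A.IsPolyTime id id` (rfl-equal, DefEqCheck.lean rc 0) so that
Cryptography/OneWayFunctions leaves the import cone. (why it might fail: X may be false: a p-adic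
(Dwork/Gross–Koblitz) evaluation of Γ_p(1/3) mod p in polylog, or a classical count of cubic
residues below p/3; today ((p−1)/3)! costs p^{1/2+o(1)} (BGS07) and no reduction TO it is known.)
[BostanGaudrySchost2007, CostaGerbiczHarvey2014, CosgraveDilcher2011, Tal2026ModularFactorials,
vanDamSeroussi2002]
#2 IdealLegOfEscape (crux) — DegreeOnePrimesEscape → SexticEscapeCount → the IDEAL of S_p is quantum
polynomial-time: input p (prime ≡ 1 mod 3; r = the smaller primitive cube root of 1 mod p fixes
χ_p), output the unique (a, b), a > b ≥ 0, with S_p = (a + bω)·ζ₆^k. Algorithm: T = O(log p) random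
completely-split primes q ≤ p^C, a random prime of F_p above each with its conjugates (uniform
degree-one primes); by the escape counts + the union bound over coatoms
(LinnikCubicClassGroups.RandomSamplesGenerate) they generate Cl(F_p), Cl(K_p) w.p. ≥ 1 − 1/p — NO
GRH; EHKS/Biasse–Song continuous-HSP relation lattice of these generators WITH the Galois action;
h(F_p), h(K_p), Cl(F_p)[ℓ^∞] as a Gal-module; N(S_p) = h(F_p)/h(K_p) (NormIsRelClassNumber); factor
(Shor); split ℓ ≡ 1 (6): v_λ(S_p) = v_ℓ|e_θ Cl(F_p)_ℓ|, v_λ̄ = v_ℓ|e_θ̄ …| (Mazur–Wiles, ℓ ∤ 6);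
inert/ramified ℓ from the norm; λ = gcd(ℓ, s − ω) in ℤ[ω]; normalise into a > b ≥ 0. [deps:
SexticEscapeCount, DegreeOnePrimesEscape, NormIsRelClassNumber] [difficulty: XL] (why it might fail:
Gras/Mazur–Wiles pins v_λ vs v_λ̄ of S_p only at split ℓ ≡ 1 (3) via θ-parts of Cl(F_p)_ℓ (ℓ ∤ 6, θ
≠ ω_ℓ; ℓ = p | h⁻ to check); e_θCl_ℓ needs discrete logs with Gal-action over a RANDOM large-norm
generating set (Biasse–Song/EHKS re-derived off Bach's base); a θ↔λ̄ slip outputs S̄_p.)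
[MazurWiles1984, Lang1990, Washington1997, SzmidtUrbanowiczZagier1995, BiasseSong2015, Hallgren2005,
doi:10.1145/2591796.2591860, CheungMosca2001]
#3 ArgLeg (crux, unchanged) — GRH-FREE argument leg: input p, output m < 72 with |arg(S_p ·
e^{−2πim/72})| ≤ 1/2 (arg S_p to ±28.6°). S_p = (√3/2π)·G(χ_p)·L(1, χ̄_pψ₃) (UW2000 Ch. I Thm 2;
ratio +0.27566 checked p ≤ 1600); arg G(χ_p) = Kummer's sector by van Dam–Seroussi eigenphase
estimation to ±π/12, then exact from G³ = pJ(χ,χ) — the quantum step (= KummerSector.KsMemBQP); arg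
L(1,θ̄) classically by dyadic-block Monte-Carlo of Σ_{n≤p log⁴p} θ̄(n)/n to 1/log²(3p), relative
error O(1/log p) since |L(1,θ̄)| ≫ 1/log(3p) for the COMPLEX θ̄ (Landau; no Siegel issue).
[difficulty: L] (why it might fail: Low risk: S_p explicit; S_p=(√3/2π)G(χ_p)L(1,χ̄_pψ₃) by UW2000
Ch.I Thm 2 (m=0,r=3; ratio .27566, p≤1600). Breaks only if arg L(1,θ̄) is not PPT to o(1): needs
effective |L(1,θ̄)|≫1/log 3p (MV2007 Thm 11.3–11.4, θ̄ order 6) + sampled dyadic sums; vDS Thm 1 =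
expected error; ONE uniform family.) [vanDamSeroussi2002, UrbanowiczWilliams2000,
SzmidtUrbanowiczZagier1995, MontgomeryVaughan2007, HalesHallgren2000, IrelandRosen1990]
#4 SexticEscapeCount (crux) — the GRH substitute for F_p (Linnik–Stark escape count, new here):
there is an absolute C such that for every prime p ≡ 1 (3), every abelian sextic number field F of
discriminant −27p⁴ (conductor–discriminant: F ≅ F_p = K_p(ω), the only such field), every x ≥ p^C
and every proper subgroup M of Cl(O_F): π(x) ≤ 32 · #{P prime of O_F : N(P) prime, N(P) ≤ x, [P] ∉
M}. Proof on paper: TZ2019 Thm 1.4 with K = F, L = Hilbert class field, H = G = Cl(F), Q = 1, range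
x ≥ (27p⁴·6⁶)^{c₁}; the exceptional χ₁ (real, at most one) is NOT trivial because ζ_F =
ζ·L(ψ₃)·L(χ_p)L(χ̄_p)·L(χ_pψ₃)L(χ̄_pψ₃) has no real zero in [1 − 1/(8 log(27p⁴6⁶)), 1) (Kadiri2005:
complex characters mod p, 3p are zero-free there; L(σ,χ₋₃) > 0 on (0,1); ζ(σ) < 0); so χ₁ is a
nontrivial genus character, classes with χ₁(C) = −1 hold ≥ (1/h)Li(x)(1−o(1)) primes each, and a
proper M misses ≥ h/4 of them (all h/2 if M ⊆ ker χ₁, else |M ∩ {χ₁ = −1}| = |M|/2 ≤ h/4); minus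
O(√x) primes of degree ≥ 2 and ≤ 12 ramified ones; total degree-one primes ≤ 6π(x). [difficulty: L]
(why it might fail: Rests on TZ2019 Thm 1.4 (K=F_p, L=Hilbert class field, Q=1) with ABSOLUTE
implied constants, plus 'χ₁≠1': ζ_{F_p}=ζ·L(ψ₃)·|L(χ_p)|²|L(χ_pψ₃)|² has no real zero in
1−1/(8log(27p⁴6⁶)) (Kadiri ZFR for complex χ; L(σ,χ₋₃)>0) — a slip there, or in ramified/degree-2
bookkeeping, breaks the fixed 32/C.) [ThornerZaman2019 Thm 1.4 (arXiv:1803.02823 pp. 2–3, READ),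
Stark1974, Kadiri2005, Washington1997 Thm 3.11 (conductor–discriminant),
LagariasMontgomeryOdlyzko1979, Weiss1983, KadiriNgWong2019]
#5 DegreeOnePrimesEscape (crux, SHARED verbatim with route LinnikCubicClassGroups,
stmt-QuantumAdvantage-11543) — for every n there is C = C(n) such that for every number field K of
degree n with NO quadratic subfield, every x ≥ |D_K|^C and every proper subgroup M of Cl(O_K): π(x)
≤ 8 · #{P prime of O_K : N(P) prime, N(P) ≤ x, [P] ∉ M}; used here at n = 3 for the cyclic cubic K_p
of discriminant p² (odd degree ⇒ no quadratic subfield; Stark: no Siegel zero of ζ_{K_p}).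
[difficulty: L] (why it might fail: Stark does not bar ζ_K's own Siegel zero even at n=3 (TZ region
1−1/(8log27D) ⊋ Stark's 1−1/(24logD)): the fixed '8' needs depletion x^(β₁−1)≤e^(−C/(4n!)) (C≥8n!)
and an ABSOLUTE O-constant in TZ Thm 1.4 at (F,L,H,Q)=(K,H_K,Cl K,1); a slip there or in deg≥2-prime
bookkeeping breaks the constants.) [ThornerZaman2019 Thm 1.4, Stark1974, MurtyMurty1997 Cor 6.2,
Weiss1983, KadiriNgWong2019]
#6 FactorialFromPincer (crux) — the pincer's last inch as ONE crux (badge repair: only cruxes may be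
hypotheses of `closes`): IdealLeg → ArgLeg → f ∈ FBQP (both antecedents inlined verbatim). From (a,
b) and m the unit k ∈ ℤ/6 is unique (candidates 60° apart, estimate ±28.6°); S_p = (a+bω)ζ₆^k
exactly; t from S_p mod 3 (DigitCongruence); for p ≡ 4,7 (9) the three cube roots of (−1)^K/L
(JacobiCube; deterministic cube root since 3 ∥ p−1) have distinct χ-values, pick c with c^K ≡ r^t: c
= ((p−1)/3)! mod p; classical steps (AKS, r, Euclid in ℤ[ω], Cornacchia for L, cube roots) folded
with the two quantum subroutines into ONE uniform family. Its foreseen split is already on file as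
supports: ThirdFactorialGlue → DigitCongruence → JacobiCube → FactorialFromPincer is pure logic
(planner Sketch.lean). [deps: IdealLeg, ArgLeg, DigitCongruence, JacobiCube, ThirdFactorialGlue]
[difficulty: L] (why it might fail: As typed needs ONE uniform Clifford+T family composing two
IsQSolvable subroutines under classical control (BQP^BQP = BQP for search problems: not in the tree)
plus the two congruences; mathematically only unit/digit bookkeeping (60° vs ±28.6°, cube-root
choice for p ≡ 4,7 (9)) can slip.) [vanDamSeroussi2002, Watrous2009, BernsteinVazirani1997,
IrelandRosen1990 Ch. 9, BerndtEvans1981]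
#7 BitwiseSearchToDecision (crux here, support in LinnikCubicClassGroups; SHARED
stmt-QuantumAdvantage-12110) — bitwise search-to-decision: an FBQP function of exactly polynomial
output length is PPT-computable if BQP ⊆ BPP (read wire i as a BQP language, amplify to error <
1/(3p(|x|)), concatenate); the former shared SearchToDecision (stmt-0235, Shor/DarkClassGroups) with
`IsPPT A id` unfolded to `A.IsPolyTime id id` (Iff.rfl) so that Cryptography/OneWayFunctions leaves
the import cone. Routine on paper; a crux only because `closes` must rest on cruxes and no proof has
landed — one proof closes it for four routes. [difficulty: M] (why it might fail: Routine on paper;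
as typed it needs BPP error-reduction and a p(|x|)-fold sequential composition INSIDE
RandAlg.IsPolyTime (time bounds compose, coins concatenate) — lemmas absent from the tree today;
fails only if RandAlg's cost model forbids adaptive composition.) [Aaronson2010 §1,
BernsteinVazirani1997 §8, Literature.Computability.Complexity.RandAlg]
#9 IdealLeg (support) — the UNCONDITIONAL ideal leg stand-alone (= IdealLegOfEscape's conclusion;
glue once #2, #4, #5 close, a direct-attack target meanwhile; first antecedent of #6). [difficulty:
XL alone / glue given the cruxes] [BiasseSong2015, ThornerZaman2019, MazurWiles1984]
#9 DigitCongruence (support) — PROVABLE NOW (finite sums in ZMod p and ℂ): for p ≡ 1 (3), r the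
smaller primitive cube root of 1 mod p, K = (p−1)/3, χ(j) = ω^i ⟺ j^K ≡ r^i: ∃ t < 3 with (K!)^K ≡
r^t and S_p ≡ K − (1−ω)·t (mod 3ℤ[ω]); card face (D), kit-checked for 711 primes and all p < 400.
[difficulty: provable-now] [IrelandRosen1990, GrossKoblitz1979, Washington1997]
#9 JacobiCube (support) — Jacobi/Gauss: for p ≡ 1 (3) there are L, M with 4p = L² + 27M², L ≡ 1 (3)
(L unique), and ((p−1)/3)!³·L ≡ (−1)^{(p−1)/3} (mod p) (Jacobi's binomial theorem + Wilson;
script-checked p < 400). [difficulty: L] [BerndtEvans1981, IrelandRosen1990, CosgraveDilcher2011,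
doi:10.1090/S0002-9947-1984-0722765-7]
#9 ThirdFactorialGlue (support) — the finer GLUE IdealLeg → ArgLeg → DigitCongruence → JacobiCube →
f ∈ FBQP (the composition step of #6 with the two congruences as hypotheses; with DigitCongruence
and JacobiCube it yields FactorialFromPincer by pure logic — the foreseen split of #6, kept
claimable). [difficulty: L] [vanDamSeroussi2002, Watrous2009, BernsteinVazirani1997]
#9 NormIsRelClassNumber (support) — face (N), a THEOREM (relative class number formula with the odd
characters ψ₃, χψ₃, χ̄ψ₃ of F_p, w = 6, Q = 1, plus SUZ): |S_p|²·h(K) = h(F) for K cubic of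
discriminant p² and F abelian sextic of discriminant −27p⁴; bnfinit-exact for all 45 such p < 500;
the NORM input of IdealLegOfEscape. [difficulty: XL] [Washington1997, SzmidtUrbanowiczZagier1995,
UrbanowiczWilliams2000]
#9 PadLemma (support) — PROVABLE NOW: an Eisenstein integer with 3 ∤ N is determined by its
associate class and its residue mod 3 (μ₆ → (ℤ[ω]/3)^× bijective), stated on the six explicit
associates; links Kummer's sector and the factorial trit when 3 ∤ h⁻. [difficulty: provable-now]
[IrelandRosen1990, Washington1997]
#9 GaussFactorialClassical (support) — ¬X, THE KILL (restated 1:1, IsPPT unfolded, rfl-equal): a PPT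
algorithm for the third-factorial bit-function (equivalently for cubic-residue counts in (0, p/3),
or — given class groups — for Kummer's sector); unranked; refuters push here: a printed polylog
evaluation of Γ_p(1/3) mod p / Gauss factorials (CosgraveDilcher2011 is O(p)), or a classical
algorithm for both h⁻ with θ/θ̄ splitting and the sector. [difficulty: open-problem]
[BostanGaudrySchost2007, CostaGerbiczHarvey2014, CosgraveDilcher2011, Tal2026ModularFactorials]

TWO-LAYER PLAN. Foreseen glued splits (nothing filed now): IdealLegOfEscape ⇐ SexticClassModule
(escape counts → (h(F_p), h(K_p), |e_θ Cl(F_p)_ℓ|, |e_θ̄ …| for split ℓ | h⁻) IsQSolvable —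
EHKS/Biasse–Song continuous HSP over the random Galois-closed base; in substance
LinnikCubicClassGroups' ContinuousHspFBQP) → MazurWilesSplit (θ-part orders = v_λ, v_λ̄ of S_p:
Gras/Mazur–Wiles + NormIsRelClassNumber) → IdealLegOfEscape; SexticEscapeCount ⇐
HilbertClassFieldChebotarevFp (TZ2019 Thm 1.4 at F_p; a Literature fact once Hecke L-functions are
expressible) → NoExceptionalZeroFp (ζ_{F_p} = product of six Dirichlet L-functions, zero-free on [1
− 1/(8 log(27p⁴6⁶)), 1): statable TODAY over Mathlib's DirichletCharacter.LFunction) →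
SexticEscapeCount; ArgLeg ⇐ KummerSectorFn (shared with KummerSector.KsMemBQP) → LOneMonteCarlo (arg
L(1,θ̄) to ±0.2 rad in FBPP) → ArgIdentity (S_p = (√3/2π)G(χ_p)L(1,θ̄)) → ArgLeg;
FactorialFromPincer ⇐ ThirdFactorialGlue → DigitCongruence → JacobiCube → FactorialFromPincer (all
three children already items; glue is pure logic).

KILL CRITERIA. GaussFactorialClassical proved (a PPT algorithm for ((p−1)/3)! mod p — equivalently
for cubic-residue counts below p/3) ⇒ close `refuted:GaussFactorialHard`; the earned items survive
as theorems. IdealLegOfEscape refuted AS A SPEC cannot happen (N(S_p) = h⁻ ≥ 1, unique sector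
representative); refuted in substance only if Mazur–Wiles does not deliver the λ/λ̄ split — pivot to
the density-one version (norm + argument pin S_p unless two Eisenstein integers of norm h⁻ lie
within 1/log p in angle) and restate X on that set — or if a step of Hallgren05/EHKS14/BS16 other
than generation needs GRH (none found) — then the ERH antecedent returns as a CRUX of a conditional
twin, not here. SexticEscapeCount refuted AS TYPED (constants 32 / C, a ramified or degree-2 slip) ⇒
restate with TZ's constants; refuted in substance would contradict TZ2019 Thm 1.4 + Kadiri2005 as
read — re-read, then close refuted:SexticEscapeCount. DegreeOnePrimesEscape: as in
LinnikCubicClassGroups (both routes break and repair together). FactorialFromPincer / ArgLeg /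
NormIsRelClassNumber refuted ⇒ a sign, unit or constant slip: restate. BQP = BPP proved elsewhere
moots everything; FACT ∈ BPP does NOT touch this route.

NOT DECOMPOSED YET. The class-group-with-Galois-action subroutine and the Mazur–Wiles bookkeeping
(children of IdealLegOfEscape); the two analytic inputs behind SexticEscapeCount (TZ2019 Thm 1.4 at
F_p — unstatable as a Literature fact today — and the statable NoExceptionalZeroFp); the approximate
F_p / |χ⟩ / Hadamard-test layer and the Monte-Carlo L(1) lemma (children of ArgLeg); the GENERAL-N
engine dropped here (former crux AllGaussFactorialsMemFBQP, ERH-typed: for N ≥ 4 the field contains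
the Legendre character mod p, so GRH-freeness needs a no-Siegel hypothesis for (·/p) — card K4, a
separate conditional line); the p ≡ 1 (mod 9) case (order-9 characters; only real character still
χ₋₃, so the escape count extends — recorded, not filed); the certificate face (S_p or the sector in
NP ∩ coNP — card P6); the reformulation "X ⟺ counting cubic residues in (0, p/3) is hard" —
recorded, not an item.

CHEAPEST FALSIFIER. (i) The card's check_items.py (pure Python, seconds): DigitCongruence,
JacobiCube, the IdealLeg/ArgLeg output specs and PadLemma for the 37 primes p ≡ 1 (3) below 400 — 0
failures at open; one PARI line per p (bnfinit) for NormIsRelClassNumber, 45/45 exact, p < 500. (ii)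
For SexticEscapeCount a refuter's kit job: for the 45 fields F_p, p < 500 (bnfinit + bnfcertify,
GRH-free) draw random completely-split q ≤ p⁶, a random prime above each, and count draws until they
generate Cl(F_p) — expect O(log h); and READ TZ2019 Thm 1.4 p. 3 ('at most one real Hecke character
χ₁', χ₁ = 1 allowed — hence the ζ_{F_p} factorisation step) against Kadiri2005's region at q = p,
3p. (iii) Literature: a printed polylog algorithm for ((p−1)/3)! mod p (Tal2026ModularFactorials
READ: none, √(p/q) there; CosgraveDilcher2011 O(p)). (iv) Mazur–Wiles scope: Washington1997 §15 /
MazurWiles1984 p. 216 ("χ odd, p ∤ [K:ℚ]").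

NUMBERS. Classical: n! mod p in p^{1/2+o(1)} (BostanGaudrySchost2007); Gauss factorials O(p)
(CosgraveDilcher2011). Quantum: Tal2026 Õ(q^c + √(p/q)) for q | p−1 under a divisor promise; vDS
phase to ±ε in O(ε⁻¹ polylog p); class groups of fixed degree poly(log |d|) GIVEN generators
(Hallgren2005, BiasseSong2015; Bach1990's 12 log²|d| base needs GRH, the random base none),
|d_{F_p}| = 27p⁴, |d_{K_p}| = p². Analytic: TZ2019 range x ≥ (D_K n^n)^{c₁}, β₁ = 1 − λ₁/log(D_K
n^n), λ₁ < 1/8; Kadiri2005: σ ≥ 1 − 1/(6.41 log(q·max(1,|t|))) zero-free but for one real zero of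
one real χ, and 8 log(27p⁴6⁶) > 32 log p ≫ 6.41 log 3p; |L(1,θ̄)| ≫ 1/log(3p); angular budget 60°
between units, tolerance 28.6°. Data (card): (N),(B),(D) for 711 primes p < 12000, 0 exceptions; (N)
bnfinit-exact, 45 fields. Items: 14 at open; 15 after route-repair 2026-08-16 (X + 6 cruxes — 2
shared with LinnikCubicClassGroups —, 7 support, 1 assembly; `closes` rests on the 7 crux-badged
items only); dropped ERHHyp, ExtendedRiemannHypothesis, IdealLegOfERH, AllGaussFactorialsMemFBQP,
SearchToDecision.

DEFINITION REQUESTS. None needed (BQP, FBQP, IsQSolvable, RandAlg.IsPolyTime, decodeNat,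
NumberField.classNumber/discr, ClassGroup.mk0, Ideal.absNorm, Nat.primeCounting, ZMod, Complex.arg
exist). Convenience defs a grounder may file: `cubicCharSmallRoot p`, `shortCubicSum p` (= S_p).
Literature cites wanted later (NOT in the cone now): MazurWiles1984 (Gras, odd part);
SzmidtUrbanowiczZagier1995; Washington1997 Thm 4.17; vanDamSeroussi2002 Thm 1; ThornerZaman2019 Thm
1.4 (once Hecke L-functions are expressible); Kadiri2005 (statable over
DirichletCharacter.LFunction).

Novelty: Searches (2026-08-15/16): the sub's 45 Theses + Ideas dir (cards third-factorial-pincer-v2,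
linnik-lights-the-class-group-v2; routes KummerSector, CentralFactorial, DarkClassGroups, Shor);
`ledger negatives` (5; only KummerSector.KsNotFrobenian adjacent, not restated); `lit read
arxiv:2607.29453` pp. 1–9, 17–18, 31; `lit cite` 10.1007/BF01388599, 10.4064/aa-71-3-273-278,
10.2307/1971226; `lit search "Gauss factorial modulo prime quantum algorithm"` / `lit galaxy search`
(rc 75 then; card audit zbMATH/Crossref/arXiv: only Cosgrave–Dilcher, BGS, 2207.07804).
Nearest prior art found: arXiv:2607.29453 (Tal2026ModularFactorials) — exact Jacobi-sum
reconstruction (Stickelberger ideal + Biasse–Song S-units + van Dam–Seroussi phase), n! mod p in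
Õ(q^c + √(p/q)), the Gauss factorial ((p−1)/q)! its √(p/q) bottleneck; quant-ph/0207131 (phase
primitive); MazurWiles1984 / Washington1997 Thm 4.17 / SzmidtUrbanowiczZagier1995 (identities, not
used algorithmically); hub: KummerSector (sector only), CentralFactorial (N = 2, 4).
Delta: the pincer moves one level up — from a Jacobi sum with KNOWN ideal to B_{1,χψ₃}, whose ideal
is UNKNOWN and is read off Cl(K_p(ω)) via Mazur–Wiles — resolving the μ₃-ambiguity of ((p−1)/3)! Tal
pays √p for; and since rev 7 it does so WITHOUT ERH: Cl(F_p), Cl(K_p) are generated by random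
degree-one primes via Linnik–Stark escape counts (ThornerZaman2019 Thm 1.4; ζ_{F_p} has no real
exceptional character), not Bach's ERH base.
Claimed grade: new-combination  [refs: 10.1007/BF01388599, 10.4064/aa-71-3-273-278, 10.2307/1971226, 2607.29453, arxiv:2607.29453, MazurWiles1984, Washington1997, SzmidtUrbanowiczZagier1995, ThornerZaman2019]

Barriers (technique_class: conditional-bridge, quantum-algorithm, number-theory): - technique_class: conditional-bridge, quantum-algorithm, number-theory
- Literature.Barriers.QuantumAdvantage.SeparationPrerequisites: not evaded — X = GaussFactorialHard
is hypothesis-type (X ∧ f ∈ FBQP ⟹ S ⟹ PP ⊄ BPP) and never staffed for proof; the bet is a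
factoring-independent, promise-free hardness hypothesis plus earned content with NO unproved
arithmetic hypothesis since rev 7 (the six other cruxes; ERH has left the route).
- Literature.Barriers.QuantumAdvantage.Relativization: bites only a proof of X (f ∈ FPSPACE); the
inclusions are explicit oracle-free families (as Shor, KummerSector).
- Literature.Barriers.QuantumAdvantage.Algebrization: same status as Relativization.
- Literature.Barriers.QuantumAdvantage.TotalFunctionSpeedupLimit: consistent — f is white-box,
total, promise-free; its quantisation is algebraic (S_p ∈ ℤ[ω], units 60° apart, Wilson/Jacobi), so
query-model D ≤ O(Q⁴)/pseudo-deterministic limits do not apply.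
- Literature.Barriers.QuantumAdvantage.RandomOracleMethod: n/a (no average-case claim).
- Literature.Barriers.QuantumAdvantage.NaturalProofs: n/a (uniform classes, no circuit lower bound).
- Literature.Barriers.QuantumAdvantage.PPolyOracles: n/a (no oracle).
- Negatives index: 5 refuted statements (2026-08-16); only KummerSector.KsNotFrobenian (degenerate
Frobenian clause) is adjacent and it is not restated — no Frobenian/equidistribution/density item is
filed (sector×trit independence is card data, not an item).

History (route lifecycle, newest last):
- 2026-08-16T03:30:04Z · rev 7: restated Assembly (stmt-QuantumAdvantage-14447) — route-choice (operator hold bridge-only), option (a) step 3 (cleanup): the premise is now carried BY NAME by crux ExtendedRiemannHypothesis (stmt-QuantumAdvanta (planner-rchoice-QuantumAdvantage-ThirdFactoria-00a5af04-0)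
- 2026-08-16T03:30:04Z · rev 7: dropped ERHHyp — route-choice (operator hold bridge-only), option (a) step 3 (cleanup): the premise is now carried BY NAME by crux ExtendedRiemannHypothesis (stmt-QuantumAdvanta (planner-rchoice-QuantumAdvantage-ThirdFactoria-00a5af04-0)
- 2026-08-16T03:45:40Z · rev 7: restated GaussFactorialHard (stmt-QuantumAdvantage-11640), GaussFactorialClassical (stmt-QuantumAdvantage-11651), Assembly (stmt-QuantumAdvantage-14519) — route-repair (cone guardrail + hold bridge-only) 2/4: the UNCONDITIONAL re-route proper — add cruxes IdealLegOfEscape (#2: escape counts → the ideal of S_p is (planner-rbadge-QuantumAdvantage-ThirdFactorial-bb1808d5-0)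
- 2026-08-16T03:45:40Z · rev 7: dropped SearchToDecision — route-repair (cone guardrail + hold bridge-only) 2/4: the UNCONDITIONAL re-route proper — add cruxes IdealLegOfEscape (#2: escape counts → the ideal of S_p is I (planner-rbadge-QuantumAdvantage-ThirdFactorial-bb1808d5-0)
- 2026-08-16T03:52:49Z · AUTO-CRUX (edit): GaussFactorialHard — hypotheses of the deciding theorem that nothing in the route derives are cruxes (planner-rbadge-QuantumAdvantage-ThirdFactorial-bb1808d5-0)
- 2026-08-16T03:57:24Z · rev 8: restated Assembly (stmt-QuantumAdvantage-14543) — route-repair 3/5 (badge: glue.non-crux-hypothesis): `closes` now rests on crux-badged items only — new crux FactorialFromPincer (#6: IdealLeg → ArgLeg → f ∈ FBQ (planner-rbadge-QuantumAdvantage-ThirdFactorial-bb1808d5-0)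
- 2026-08-16T04:39:12Z · rev 16: restated IdealLegOfEscape (stmt-QuantumAdvantage-14544), ArgLeg (stmt-QuantumAdvantage-11644), FactorialFromPincer (stmt-QuantumAdvantage-14572), IdealLeg (stmt-QuantumAdvantage-11642) — repair (route-repair unit rrefute-…-f2c63463): FactorialFromPincer stmt-QuantumAdvantage-14572 refuted-MISSTATED by refuter-r (planner-rrefute-QuantumAdvantage-ThirdFactoria-f2c63463-0)
- 2026-08-26T15:41:24Z · DORMANT — reconciler: no traction for 6.5 d (last activity item-evidence-added at 2026-08-20T02:36:12Z); parked, not closed — `ledger route dormant route-QuantumAdvantage (operator:999:2729964)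

sub-problem: QuantumAdvantage · status: dormant · opened planner-plancard-QuantumAdvantage-QuantumAdva-f51f52ae-0 2026-08-15T18:34:19Z · rev 19 · ledger route-QuantumAdvantage-ThirdFactorialPincer
GENERATED by the gate from the ledger (D-0016/17). Provers cite these decls: `theorem foo : Summit.QuantumAdvantage.QuantumAdvantage.Theses.ThirdFactorialPincer.<Decl> := …` in Summits/QuantumAdvantage/QuantumAdvantage/Theorems/<Name>.lean.
-/

namespace Summit.QuantumAdvantage.QuantumAdvantage.Theses.ThirdFactorialPincer

open scoped BigOperators Topology Manifold Classical MeasureTheory ProbabilityTheory Matrix InnerProductSpace ComplexConjugate ContinuousMap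
open Filter Set Function TopologicalSpace MeasureTheory

attribute [summit_statement] _root_.QuantumAdvantage
attribute [route_premise "route-QuantumAdvantage-ThirdFactorialPincer"] _root_.Literature.NumberTheory.LFunctions.ExtendedRiemannHypothesis

open Literature.QuantumAdvantage

-- earlier GaussFactorialHard (stmt-QuantumAdvantage-11640, replaced 2026-08-16T03:45:40Z -> stmt-QuantumAdvantage-14541): retired by None — ¬ ∃ A : Literature.Computability.Complexity.RandAlg (List Bool) (List Bool), Literature.Computability.Cryptography.IsPPT A id ∧ ∀ x : List Bool, (2 : ℝ) / 3 ≤ A.pr id x {List.ofFn (fun i : Fin x.length => (if (Computability.decodeNat x).Prime ∧ (Computability.de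
/-- item stmt-QuantumAdvantage-14541 · crux (kind.auto-crux: conjecture-grade) · rank 0 · open · by planner
why it might fail: X is ONE TRIT: given (K!)³≡(−1)^K/L (Jacobi) and cube roots, X ⟺ t_p=χ_p(((p−1)/3)!) — 2nd (1−ω)-adic digit of B_{1,χ_pψ₃}, i.e. cubic-residue counts in (0,p/3) mod 3 — is not PPT. A closed SUZ/UW2000-type congruence in L,M (4p=L²+27M²) or a Frobenian law for t_p kills X; n! mod p: p^{1/2+o(1)}.
sources: BostanGaudrySchost2007, CostaGerbiczHarvey2014, CosgraveDilcher2011, Tal2026ModularFactorials, SzmidtUrbanowiczZagier1995, UrbanowiczWilliams2000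
[target] X — no PPT algorithm outputs with probability ≥ 2/3, on every x, the |x| low bits of
((p−1)/3)! mod p for p = decodeNat x prime, p ≡ 4, 7 (mod 9) (0 otherwise). Hypothesis-type (card
K2); its negation GaussFactorialClassical is filed as the kill. Route-repair 2026-08-16: restated
1:1 with the abbreviation `IsPPT A id` unfolded to `A.IsPolyTime id id` (Iff.rfl with the former
stmt-QuantumAdvantage-11640, planner DefEqCheck.lean rc 0) so that Cryptography/OneWayFunctions
leaves the import cone. [difficulty: open-problem] -/
@[route_item "route-QuantumAdvantage-ThirdFactorialPincer", crux]
def GaussFactorialHard : Prop :=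
  ¬ ∃ A : Literature.Computability.Complexity.RandAlg (List Bool) (List Bool), A.IsPolyTime id id ∧ ∀ x : List Bool, (2 : ℝ) / 3 ≤ A.pr id x {List.ofFn (fun i : Fin x.length => (if (Computability.decodeNat x).Prime ∧ (Computability.decodeNat x % 9 = 4 ∨ Computability.decodeNat x % 9 = 7) then Nat.factorial ((Computability.decodeNat x - 1) / 3) % Computability.decodeNat x else 0).testBit i.val)}

-- earlier IdealLegOfEscape (stmt-QuantumAdvantage-14544, replaced 2026-08-16T04:39:12Z -> stmt-QuantumAdvantage-14636): retired by None — (∀ n : ℕ, ∃ C : ℕ, ∀ (K : Type) [Field K] [NumberField K], Module.finrank ℚ K = n → (∀ F : IntermediateField ℚ K, Module.finrank ℚ F ≠ 2) → ∀ x : ℕ, |NumberField.discr K| ^ C ≤ (x : ℤ) → ∀ M : Subgroup (ClassGroup (NumberField.RingOfIntegers K)), M ≠ ⊤ → Nat.prime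
/-- item stmt-QuantumAdvantage-14636 · crux · rank 2 · open · by planner
why it might fail: Gras/Mazur–Wiles pins v_λ vs v_λ̄ of S_p only at split ℓ ≡ 1 (3) via θ-parts of Cl(F_p)_ℓ (ℓ ∤ 6, θ ≠ ω_ℓ; ℓ = p | h⁻ to check); e_θCl_ℓ needs discrete logs with Gal-action over a RANDOM large-norm generating set (Biasse–Song/EHKS re-derived off Bach's base); a θ↔λ̄ slip outputs S̄_p.
sources: MazurWiles1984, Lang1990 (Rubin appendix, Thm 8.8), Washington1997 Thm 4.17, §15, SzmidtUrbanowiczZagier1995, BiasseSong2015 (doi:10.1137/1.9781611974331.ch64), Hallgren2005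
[crux] DegreeOnePrimesEscape → SexticEscapeCount → the IDEAL of S_p is quantum polynomial-time (the
two antecedents are this route's escape cruxes #5 and #4 inlined verbatim — definitionally equal —
so that the file elaborates in rank order): input p (prime ≡ 1 mod 3; r = the smaller primitive cube
root of 1 mod p fixes χ_p(j) = ω^i ⟺ j^{(p−1)/3} ≡ r^i), output the unique (a, b), a > b ≥ 0, with
S_p = (a + bω)·ζ₆^k (card K1, ideal leg), as the 2|x|+2 low bits of Nat.pair a b on the first 2|x|+2
wires. Algorithm: T = O(log p) random primes q ≤ p^C split completely in F_p = K_p(ω), a random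
prime of F_p above each with its conjugates (uniform over degree-one primes); by the escape counts +
the union bound over coatoms (LinnikCubicClassGroups.RandomSamplesGenerate, provable now) they
generate Cl(F_p) and Cl(K_p) w.p. ≥ 1 − 1/p — NO GRH, no Siegel hypothesis; EHKS/Biasse–Song
continuous-HSP relation lattice of these generators WITH the Galois action (discrete logs of σ(P));
h(F_p), h(K_p), Cl(F_p)[ℓ^∞] as a Gal-module; N(S_p) = h(F_p)/h(K_p) (NormIsRelClassNumber); factor
it (Shor); split ℓ ≡ 1 (6): v_λ(S_p) = v_ℓ|e_θ Cl(F_p)_ℓ|, v_λ̄ = v_ℓ|e_θ̄ …| (Mazur–Wiles / Gras, ℓ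
∤ [F_p:ℚ] = 6) -/
@[route_item "route-QuantumAdvantage-ThirdFactorialPincer", crux]
def IdealLegOfEscape : Prop :=
  (∀ n : ℕ, ∃ C : ℕ, ∀ (K : Type) [Field K] [NumberField K], Module.finrank ℚ K = n → (∀ F : IntermediateField ℚ K, Module.finrank ℚ F ≠ 2) → ∀ x : ℕ, |NumberField.discr K| ^ C ≤ (x : ℤ) → ∀ M : Subgroup (ClassGroup (NumberField.RingOfIntegers K)), M ≠ ⊤ → Nat.primeCounting x ≤ 8 * Set.ncard {P : Ideal (NumberField.RingOfIntegers K) | P.IsPrime ∧ (Ideal.absNorm P).Prime ∧ Ideal.absNorm P ≤ x ∧ ∃ hP : P ∈ nonZeroDivisors (Ideal (NumberField.RingOfIntegers K)), ClassGroup.mk0 ⟨P, hP⟩ ∉ M}) → (∃ C : ℕ, ∀ (p : ℕ) (F : Type) [Field F] [NumberField F], p.Prime → p % 3 = 1 → Module.finrank ℚ F = 6 → IsGalois ℚ F → (∀ σ τ : F ≃ₐ[ℚ] F, σ * τ = τ * σ) → NumberField.discr F = -(27 * (p : ℤ) ^ 4) → ∀ x : ℕ, p ^ C ≤ x → ∀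 M : Subgroup (ClassGroup (NumberField.RingOfIntegers F)), M ≠ ⊤ → Nat.primeCounting x ≤ 32 * Set.ncard {P : Ideal (NumberField.RingOfIntegers F) | P.IsPrime ∧ (Ideal.absNorm P).Prime ∧ Ideal.absNorm P ≤ x ∧ ∃ hP : P ∈ nonZeroDivisors (Ideal (NumberField.RingOfIntegers F)), ClassGroup.mk0 ⟨P, hP⟩ ∉ M}) → Literature.Computability.Cryptography.IsQSolvable fun x => {y | ∀ p r : ℕ, Computability.decodeNat x = p → p.Prime → p % 3 = 1 → r < p → (r * r + r + 1) % p = 0 → 2 * r + 1 < p → ∃ a b k : ℕ, b < a ∧ k < 6 ∧ (∑ j ∈ Finset.Icc 1 ((p - 1) / 3), (if (j : ZMod p) ^ ((p - 1) / 3) = 1 then (1 : ℂ) else if (j : ZMod p) ^ ((p - 1) / 3) = (r : ZMod p) then Complex.exp (2 * Real.pi * Complex.I / 3) else Complex.exp (2 * Real.pi * Complex.I / 3) ^ 2)) = ((a : ℂ) + (b : ℂ) * Complex.exp (2 * Real.pi * Complex.I / 3)) * Complex.exp (Real.pi * Complex.I * (k : ℂ) / 3) ∧ List.ofFn (fun i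 : Fin (2 * x.length + 2) => (Nat.pair a b).testBit i.val) <+: y}

-- earlier ArgLeg (stmt-QuantumAdvantage-11644, replaced 2026-08-16T04:39:12Z -> stmt-QuantumAdvantage-14637): retired by None — Literature.Computability.Cryptography.IsQSolvable fun x => {y | ∀ p r : ℕ, Computability.decodeNat x = p → p.Prime → p % 3 = 1 → r < p → (r * r + r + 1) % p = 0 → 2 * r + 1 < p → ∃ m : ℕ, m < 72 ∧ |Complex.arg ((∑ j ∈ Finset.Icc 1 ((p - 1) / 3), (if (j : ZMod p) ^ ((p - 1) 
/-- item stmt-QuantumAdvantage-14637 · crux · rank 3 · open · by planner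
why it might fail: Low risk: S_p explicit; S_p=(√3/2π)G(χ_p)L(1,χ̄_pψ₃) by UW2000 Ch.I Thm 2 (m=0,r=3; ratio .27566, p≤1600). Breaks only if arg L(1,θ̄) is not PPT to o(1): needs effective |L(1,θ̄)|≫1/log 3p (MV2007 Thm 11.3–11.4, θ̄ order 6) + sampled dyadic sums; vDS Thm 1 = expected error; ONE uniform family.
sources: vanDamSeroussi2002, UrbanowiczWilliams2000, SzmidtUrbanowiczZagier1995, MontgomeryVaughan2007, HalesHallgren2000, IrelandRosen1990
[crux] GRH-FREE argument leg (card K1 argument leg + P2): input p (prime ≡ 1 mod 3, r as above),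
output m < 72 with |arg(S_p · e^{−2πim/72})| ≤ 1/2 — i.e. arg S_p to ±28.6° — as 7 bits on the first
7 wires. Algorithm: S_p = (√3/2π)·G(χ_p)·L(1, χ̄_pψ₃) (G(χ) = Σχ(x)e(x/p), θ̄ = χ̄ψ₃; from
Pólya/SUZ, L(1,θ̄) via τ(θ̄)B_{1,θ}, τ(θ̄) = χ̄(3)τ(χ̄)τ(ψ₃); ratio checked = +0.27566 for p = 7…43
this session, p ≤ 1600 by the card); arg G(χ_p) = Kummer's sector (van Dam–Seroussi eigenphase of
χ²∘F_p on |χ⟩ to ±π/12, then exact from G³ = pJ(χ,χ)) — the quantum step, = route KummerSector's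
KsMemBQP as a subroutine; arg L(1,θ̄) classically: Σ_{n≤p log⁴p} θ̄(n)/n by dyadic-block Monte-Carlo
to absolute error 1/log²(3p) (Hoeffding; tail by Pólya–Vinogradov), which is relative error O(1/log
p) since |L(1,θ̄)| ≫ 1/log(3p) for the COMPLEX character θ̄ (Landau; no Siegel zero issue).
Route-repair 2026-08-16 (refuter-rattack-stmt-QuantumAdvantage-14572: the `encodeNat v <+: y` output
convention was void as an interface — encodeNat 0 = [] is a prefix of every read-out and encodeNat
is not prefix-free): the output is now written FIXED-WIDTH on the first wires, little-endian
`List.ofFn (fun i : Fin w => v -/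
@[route_item "route-QuantumAdvantage-ThirdFactorialPincer", crux]
def ArgLeg : Prop :=
  Literature.Computability.Cryptography.IsQSolvable fun x => {y | ∀ p r : ℕ, Computability.decodeNat x = p → p.Prime → p % 3 = 1 → r < p → (r * r + r + 1) % p = 0 → 2 * r + 1 < p → ∃ m : ℕ, m < 72 ∧ |Complex.arg ((∑ j ∈ Finset.Icc 1 ((p - 1) / 3), (if (j : ZMod p) ^ ((p - 1) / 3) = 1 then (1 : ℂ) else if (j : ZMod p) ^ ((p - 1) / 3) = (r : ZMod p) then Complex.exp (2 * Real.pi * Complex.I / 3) else Complex.exp (2 * Real.pi * Complex.I / 3) ^ 2)) * Complex.exp (-(2 * Real.pi * Complex.I * (m : ℂ) / 72)))| ≤ 1 / 2 ∧ List.ofFn (fun i : Fin 7 => m.testBit i.val) <+: y}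

/-- item stmt-QuantumAdvantage-14545 · crux · rank 4 · closed · proved by Summit.QuantumAdvantage.QuantumAdvantage.Theorems.SexticEscapeCount.sexticEscapeCount_proof @ a25a0ff2463b (prover) · by planner
why it might fail: Rests on TZ2019 Thm 1.4 (K=F_p, L=Hilbert class field, Q=1) with ABSOLUTE implied constants, plus 'χ₁≠1': ζ_{F_p}=ζ·L(ψ₃)·|L(χ_p)|²|L(χ_pψ₃)|² has no real zero in 1−1/(8log(27p⁴6⁶)) (Kadiri ZFR for complex χ; L(σ,χ₋₃)>0) — a slip there, or in ramified/degree-2 bookkeeping, breaks the fixed 32/C.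
sources: ThornerZaman2019 Thm 1.4 (arXiv:1803.02823 pp. 2–3, READ), Stark1974, Kadiri2005, Washington1997 Thm 3.11 (conductor–discriminant), LagariasMontgomeryOdlyzko1979, Weiss1983
[crux] the GRH substitute for F_p = K_p(ω) (Linnik–Stark escape count, new at route-repair
2026-08-16): there is an absolute C such that for every prime p ≡ 1 (3), every abelian sextic number
field F of discriminant −27p⁴ (≅ F_p by conductor–discriminant, the only such field), every x ≥ p^C
and every proper subgroup M of Cl(O_F): π(x) ≤ 32 · #{P prime of O_F : N(P) prime, N(P) ≤ x, [P] ∉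
M}. Proof on paper: ThornerZaman2019 Thm 1.4 with K = F, L = Hilbert class field, H = G = Cl(F), Q =
1, range x ≥ (27p⁴·6⁶)^{c₁}; the (at most one, real) exceptional character χ₁ is NOT trivial because
ζ_F = ζ·L(ψ₃)·L(χ_p)L(χ̄_p)·L(χ_pψ₃)L(χ̄_pψ₃) has no real zero in [1 − 1/(8 log(27p⁴6⁶)), 1)
(Kadiri2005: the complex characters mod p and 3p are zero-free there; L(σ,χ₋₃) > 0 and ζ(σ) < 0 on
(0,1)); hence χ₁ is a nontrivial genus character, the h/2 classes with χ₁(C) = −1 each hold ≥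
(1/h)Li(x)(1−o(1)) primes, and a proper M misses ≥ h/4 of them (all h/2 if M ⊆ ker χ₁, else |M ∩ {χ₁
= −1}| = |M|/2 ≤ h/4); subtract O(√x) primes of degree ≥ 2 and ≤ 12 ramified ones; degree-one primes
total ≤ 6π(x). Same shape as DegreeOnePrimesEscape, which needs 'no quadratic subfield' and so does
not cover F_p ⊃ ℚ(√ -/
@[route_item "route-QuantumAdvantage-ThirdFactorialPincer", crux]
def SexticEscapeCount : Prop :=
  ∃ C : ℕ, ∀ (p : ℕ) (F : Type) [Field F] [NumberField F], p.Prime → p % 3 = 1 → Module.finrank ℚ F = 6 → IsGalois ℚ F → (∀ σ τ : F ≃ₐ[ℚ] F, σ * τ = τ * σ) → NumberField.discr F = -(27 * (p : ℤ) ^ 4) → ∀ x : ℕ, p ^ C ≤ x → ∀ M : Subgroup (ClassGroup (NumberField.RingOfIntegers F)), M ≠ ⊤ → Nat.primeCounting x ≤ 32 * Set.ncard {P : Ideal (NumberField.RingOfIntegers F) | P.IsPrime ∧ (Ideal.absNorm P).Prime ∧ Ideal.absNorm P ≤ x ∧ ∃ hP : P ∈ nonZeroDivisors (Ideal (NumberField.RingOfIntegers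 F)), ClassGroup.mk0 ⟨P, hP⟩ ∉ M}

-- `SexticEscapeCount` holds: proved by `Summit.QuantumAdvantage.QuantumAdvantage.Theorems.SexticEscapeCount.sexticEscapeCount_proof` @ a25a0ff2463b (its module imports this route file, so no `_holds` link can be stated here).

/-- item stmt-QuantumAdvantage-11543 · crux · rank 5 · closed · proved by Summit.QuantumAdvantage.QuantumAdvantage.Theorems.DegreeOnePrimesEscape.degreeOnePrimesEscape_proof @ 26269d93e3f1 (prover) · by planner
why it might fail: Stark does not bar ζ_K's own Siegel zero even at n=3 (TZ region 1−1/(8log27D) ⊋ Stark's 1−1/(24logD)): the fixed '8' needs depletion x^(β₁−1)≤e^(−C/(4n!)) (C≥8n!) and an ABSOLUTE O-constant in TZ Thm 1.4 at (F,L,H,Q)=(K,H_K,Cl K,1); a slip there or in deg≥2-prime bookkeeping breaks the constants.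
sources: arXiv:1803.02823 Thm 1.4 (ThornerZaman2019), Stark1974, MurtyMurty1997 Prop 6.1 + Cor 6.2, Weiss1983 (doi:10.1515/crll.1983.338.56), KadiriNgWong2019
[crux] card K1 corrected (Linnik–Stark escape count). For every n there is C = C(n) such that for
every number field K of degree n with NO quadratic subfield, every x ≥ |D_K|^C and every proper
subgroup M of Cl(O_K): π(x) ≤ 8 · #{P prime of O_K : N(P) prime, N(P) ≤ x, [P] ∉ M}. Proof on paper:
TZ2019 Thm 1.4 with F = K, L = Hilbert class field, H = G = Cl(K), Q = 1; Stark: ζ_K(σ) ≠ 0 on [1 −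
1/(4·n!·log|D_K|), 1) since log d_N ≤ n! log d_K and K ⊉ quadratic field, so a TZ-exceptional χ₁ is
either absent, or trivial with λ₁ ≥ 1/(4 n!) (depletion ≤ e^(−2) once C ≥ 8 n!), or a nontrivial
quadratic character with kernel K₁ of index 2 — then classes outside M ∪ K₁ number ≥ h/4 and each
holds ≥ (1−o(1)) Li(x)/h primes (sign −χ₁(C) = +1); degree ≥ 2 primes are O(n√x). [difficulty: L] -/
@[route_item "route-QuantumAdvantage-ThirdFactorialPincer", crux]
def DegreeOnePrimesEscape : Prop :=
  ∀ n : ℕ, ∃ C : ℕ, ∀ (K : Type) [Field K] [NumberField K], Module.finrank ℚ K = n → (∀ F : IntermediateField ℚ K, Module.finrank ℚ F ≠ 2) → ∀ x : ℕ, |NumberField.discr K| ^ C ≤ (x : ℤ) → ∀ M : Subgroup (ClassGroup (NumberField.RingOfIntegers K)), M ≠ ⊤ → Nat.primeCounting x ≤ 8 * Set.ncard {P : Ideal (NumberField.RingOfIntegers K) | P.IsPrime ∧ (Ideal.absNorm P).Prime ∧ Ideal.absNorm P ≤ x ∧ ∃ hP : P ∈ nonZeroDivisors (Ideal (NumberField.RingOfIntegers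 K)), ClassGroup.mk0 ⟨P, hP⟩ ∉ M}

/-- `DegreeOnePrimesEscape` holds: proved by `Summit.QuantumAdvantage.QuantumAdvantage.Theorems.DegreeOnePrimesEscape.degreeOnePrimesEscape_proof` @ 26269d93e3f1. -/
theorem DegreeOnePrimesEscape_holds : DegreeOnePrimesEscape := _root_.Summit.QuantumAdvantage.QuantumAdvantage.Theorems.DegreeOnePrimesEscape.degreeOnePrimesEscape_proof

-- earlier FactorialFromPincer (stmt-QuantumAdvantage-14572, replaced 2026-08-16T04:39:12Z -> stmt-QuantumAdvantage-14638): retired by None — (Literature.Computability.Cryptography.IsQSolvable fun x => {y | ∀ p r : ℕ, Computability.decodeNat x = p → p.Prime → p % 3 = 1 → r < p → (r * r + r + 1) % p = 0 → 2 * r + 1 < p → ∃ a b k : ℕ, b < a ∧ k < 6 ∧ (∑ j ∈ Finset.Icc 1 ((p - 1) / 3), (if (j : ZMod p) 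
/-- item stmt-QuantumAdvantage-14638 · crux · rank 6 · open · by planner
why it might fail: As typed: TWO IsQSolvable subroutines + coins for the classical steps (√−3 mod p for r, L; cube roots) + majority amplification on the unique (a,b) and on k, folded into ONE uniform family — beyond isQSolvable_classicalWrap (one subroutine, deterministic FP wrap); unit/digit bookkeeping can slip.
sources: vanDamSeroussi2002 Thm 1, Watrous2009 §III.1, BernsteinVazirani1997 §8, IrelandRosen1990 Ch. 9, BerndtEvans1981, Literature.Computability.Cryptography.isQSolvable_classicalWrap (ShorProofs.lean; _holds in QuantumComplexity/CWrapAssembly.lean)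
[crux] the pincer's last inch as ONE crux (badge repair 2026-08-16: only cruxes may be hypotheses of
`closes`): IdealLeg → ArgLeg → f ∈ FBQP, both antecedents inlined verbatim (IdealLeg = support
stmt-QuantumAdvantage-11642's statement, ArgLeg = crux #3) so the file elaborates in rank order. The
post-processor reads (a, b) off the first 2|x|+2 wires of the ideal leg and m off the first 7 wires
of the argument leg (fixed width, unambiguous); from (a, b) and m the unit k ∈ ℤ/6 is unique
(candidates 60° apart, estimate ±28.6°; S_p ≠ 0 since a > b ≥ 0); S_p = (a+bω)ζ₆^k exactly; t from
S_p mod 3 (DigitCongruence); for p ≡ 4,7 (9) the three cube roots of (−1)^K/L (JacobiCube;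
deterministic cube root since 3 ∥ p−1, times 1, r, r²) have distinct χ-values r^{·K}, pick c with
c^K ≡ r^t: c = ((p−1)/3)! mod p; classical steps (AKS, r, Euclid in ℤ[ω], Cornacchia for L, cube
roots) folded with the two quantum subroutines into ONE uniform Clifford+T family. Route-repair
2026-08-16 (refuter-rattack-stmt-QuantumAdvantage-14572: the `encodeNat v <+: y` output convention
was void as an interface — encodeNat 0 = [] is a prefix of every read-out and encodeNat is not
prefix-free): the output is now wri -/
@[route_item "route-QuantumAdvantage-ThirdFactorialPincer", crux]
def FactorialFromPincer : Prop :=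
  (Literature.Computability.Cryptography.IsQSolvable fun x => {y | ∀ p r : ℕ, Computability.decodeNat x = p → p.Prime → p % 3 = 1 → r < p → (r * r + r + 1) % p = 0 → 2 * r + 1 < p → ∃ a b k : ℕ, b < a ∧ k < 6 ∧ (∑ j ∈ Finset.Icc 1 ((p - 1) / 3), (if (j : ZMod p) ^ ((p - 1) / 3) = 1 then (1 : ℂ) else if (j : ZMod p) ^ ((p - 1) / 3) = (r : ZMod p) then Complex.exp (2 * Real.pi * Complex.I / 3) else Complex.exp (2 * Real.pi * Complex.I / 3) ^ 2)) = ((a : ℂ) + (b : ℂ) * Complex.exp (2 * Real.pi * Complex.I / 3)) * Complex.exp (Real.pi * Complex.I * (k : ℂ) / 3) ∧ List.ofFn (fun i : Fin (2 * x.length + 2) => (Nat.pair a b).testBit i.val) <+: y}) → (Literature.Computability.Cryptography.IsQSolvable fun x => {y | ∀ p r : ℕ, Computability.decodeNat x = p → p.Prime → p % 3 = 1 → r < p → (r * r + r + 1) % p = 0 → 2 * r + 1 < p → ∃ m : ℕ, m < 72 ∧ |Complex.arg ((∑ j ∈ Finset.Icc 1 ((p - 1) / 3), (if (j : ZMod p)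 ^ ((p - 1) / 3) = 1 then (1 : ℂ) else if (j : ZMod p) ^ ((p - 1) / 3) = (r : ZMod p) then Complex.exp (2 * Real.pi * Complex.I / 3) else Complex.exp (2 * Real.pi * Complex.I / 3) ^ 2)) * Complex.exp (-(2 * Real.pi * Complex.I * (m : ℂ) / 72)))| ≤ 1 / 2 ∧ List.ofFn (fun i : Fin 7 => m.testBit i.val) <+: y}) → (fun x : List Bool => List.ofFn (fun i : Fin x.length => (if (Computability.decodeNat x).Prime ∧ (Computability.decodeNat x % 9 = 4 ∨ Computability.decodeNat x % 9 = 7) then Nat.factorial ((Computability.decodeNat x - 1) / 3) % Computability.decodeNat x else 0).testBit i.val)) ∈ Literature.Computability.Cryptography.FBQP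

/-- item stmt-QuantumAdvantage-12110 · crux · rank 9 · closed · proved by Summit.QuantumAdvantage.QuantumAdvantage.Theorems.LinnikCubicClassGroups.BitwiseSearchToDecision_proof (prover) · by planner
why it might fail: Routine on paper; as typed it needs BPP error-reduction and a p(|x|)-fold sequential composition INSIDE RandAlg.IsPolyTime (time bounds compose, coins concatenate) — lemmas absent from the tree today; fails only if RandAlg's cost model forbids adaptive composition.
sources: Aaronson2010 §1 (FBQP), BernsteinVazirani1997 §8, Literature.Computability.Complexity.RandAlg.IsPolyTime, Literature.Computability.Cryptography.FBQP
[support] Bitwise search-to-decision: if f has exactly polynomial output length and f ∈ FBQP, each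
bit language {(x,i) : (f x)_i = 1} is in BQP (read wire i of the FBQP family), hence in BPP under
the collapse BQP ⊆ BPP; amplify each to error < 1/(3 p(|x|)) and concatenate, giving a PPT algorithm
A with Pr[A(x) = f x] ≥ 2/3. Same proposition as the shared stmt-QuantumAdvantage-0235 (routes
Shor/DarkClassGroups) with the abbreviation `IsPPT A id` unfolded to `A.IsPolyTime id id`
(`rfl`-equal: a proof of either is a proof of the other verbatim) so that this route does not import
Cryptography/OneWayFunctions. [difficulty: provable-now] [Aaronson2010 §1 (FBQP);
BernsteinVazirani1997 §8; folklore] -/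
@[route_item "route-QuantumAdvantage-ThirdFactorialPincer", crux]
def BitwiseSearchToDecision : Prop :=
  ∀ f : List Bool → List Bool, (∃ p : Polynomial ℕ, ∀ x, (f x).length = p.eval x.length) → f ∈ Literature.Computability.Cryptography.FBQP → Literature.Computability.Cryptography.BQP ⊆ Literature.Computability.Complexity.BPP → ∃ A : Literature.Computability.Complexity.RandAlg (List Bool) (List Bool), A.IsPolyTime id id ∧ ∀ x, 2 / 3 ≤ A.pr id x {f x}

/-- `BitwiseSearchToDecision` holds: proved by `Summit.QuantumAdvantage.QuantumAdvantage.Theorems.LinnikCubicClassGroups.BitwiseSearchToDecision_proof`. -/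
theorem BitwiseSearchToDecision_holds : BitwiseSearchToDecision := _root_.Summit.QuantumAdvantage.QuantumAdvantage.Theorems.LinnikCubicClassGroups.BitwiseSearchToDecision_proof

/-- item stmt-QuantumAdvantage-11646 · support · rank 9 · closed · proved by Summit.QuantumAdvantage.QuantumAdvantage.Theorems.DigitCongruence.digitCongruence_proof @ 7693b72459af (prover) · by planner
sources: IrelandRosen1990, GrossKoblitz1979, Washington1997
[support] PROVABLE NOW (finite sums in ZMod p and ℂ): for p ≡ 1 (3) prime and r the smaller
primitive cube root of 1 mod p, with K = (p−1)/3 and χ(j) = ω^i ⟺ j^K ≡ r^i: there is t < 3 with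
(K!)^K ≡ r^t (i.e. χ(K!) = ω^t, multiplicativity) and S_p ≡ K − (1−ω)·t (mod 3ℤ[ω]) (expand ω^i =
(1−λ)^i mod λ², λ = 1−ω, (3) = (λ²)). Card face (D); kit-checked by the card for 711 primes and here
for all p < 400. [difficulty: provable-now] -/
@[route_item "route-QuantumAdvantage-ThirdFactorialPincer"]
def DigitCongruence : Prop :=
  ∀ p r : ℕ, p.Prime → p % 3 = 1 → r < p → (r * r + r + 1) % p = 0 → 2 * r + 1 < p → ∃ t : ℕ, t < 3 ∧ ((Nat.factorial ((p - 1) / 3) : ℕ) : ZMod p) ^ ((p - 1) / 3) = (r : ZMod p) ^ t ∧ ∃ c d : ℤ, (∑ j ∈ Finset.Icc 1 ((p - 1) / 3), (if (j : ZMod p) ^ ((p - 1) / 3) = 1 then (1 : ℂ) else if (j : ZMod p) ^ ((p - 1) / 3) = (r : ZMod p) then Complex.exp (2 * Real.pi * Complex.I / 3) else Complex.exp (2 * Real.pi * Complex.I / 3) ^ 2)) = (((p - 1) / 3 : ℕ) : ℂ) - (1 - Complex.exp (2 * Real.pi * Complex.I / 3)) * (t : ℂ) + 3 * ((c : ℂ)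 + (d : ℂ) * Complex.exp (2 * Real.pi * Complex.I / 3))

-- `DigitCongruence` holds: proved by `Summit.QuantumAdvantage.QuantumAdvantage.Theorems.DigitCongruence.digitCongruence_proof` @ 7693b72459af (its module imports this route file, so no `_holds` link can be stated here).

/-- item stmt-QuantumAdvantage-11647 · support · rank 9 · closed · proved by Summit.QuantumAdvantage.QuantumAdvantage.Theorems.JacobiCube.jacobiCube_proof @ db2e9551b141 (prover) · by planner
sources: BerndtEvans1981, IrelandRosen1990, CosgraveDilcher2011, HudsonWilliams1984 doi:10.1090/S0002-9947-1984-0722765-7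
[support] Jacobi 1837 / Gauss: for p ≡ 1 (3) prime there are L, M ∈ ℤ with 4p = L² + 27M², L ≡ 1 (3)
(L unique), and ((p−1)/3)!³ · L ≡ (−1)^{(p−1)/3} (mod p) — from Jacobi's binomial theorem C(2K, K) ≡
−L and Wilson; checked by hand p = 7, 13, 19, 31, 37 and by script p < 400. Classical for the
algorithm (Cornacchia / Euclid in ℤ[ω] gives L); deep-ish to formalise (Jacobi sums J(χ,χ), Mathlib
`jacobiSum`). [difficulty: L] -/
@[route_item "route-QuantumAdvantage-ThirdFactorialPincer"]
def JacobiCube : Prop :=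
  ∀ p : ℕ, p.Prime → p % 3 = 1 → (∃ L M : ℤ, 4 * (p : ℤ) = L ^ 2 + 27 * M ^ 2 ∧ L % 3 = 1) ∧ ∀ L M : ℤ, 4 * (p : ℤ) = L ^ 2 + 27 * M ^ 2 → L % 3 = 1 → ((Nat.factorial ((p - 1) / 3) : ℕ) : ZMod p) ^ 3 * (L : ZMod p) = (-1 : ZMod p) ^ ((p - 1) / 3)

-- `JacobiCube` holds: proved by `Summit.QuantumAdvantage.QuantumAdvantage.Theorems.JacobiCube.jacobiCube_proof` @ db2e9551b141 (its module imports this route file, so no `_holds` link can be stated here).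

/-- item stmt-QuantumAdvantage-11649 · support · rank 9 · open · by planner
sources: Washington1997, SzmidtUrbanowiczZagier1995, UrbanowiczWilliams2000, IrelandRosen1990
[support] face (N) of the card, a THEOREM (relative class number formula h⁻ = Q·w·∏_{θ
odd}(−B_{1,θ}/2) with odd characters ψ₃, χψ₃, χ̄ψ₃ of F_p, B_{1,ψ₃} = −1/3, w = 6, Q = 1, plus SUZ's
S_p = −χ̄(3)B_{1,χψ₃}/2): |S_p|² · h(K) = h(F) for K the cubic field of discriminant p² (= K_p) and
F the abelian sextic field of discriminant −27p⁴ (= K_p(ω)); card: bnfinit-exact for all 45 such p <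
500. The NORM input of IdealLegOfERH, stated over Mathlib's abstract number fields. [difficulty: XL] -/
@[route_item "route-QuantumAdvantage-ThirdFactorialPincer"]
def NormIsRelClassNumber : Prop :=
  ∀ (p r : ℕ) (F K : Type) [Field F] [NumberField F] [Field K] [NumberField K], p.Prime → p % 3 = 1 → r < p → (r * r + r + 1) % p = 0 → 2 * r + 1 < p → Module.finrank ℚ K = 3 → NumberField.discr K = (p : ℤ) ^ 2 → Module.finrank ℚ F = 6 → IsGalois ℚ F → (∀ σ τ : F ≃ₐ[ℚ] F, σ * τ = τ * σ) → NumberField.discr F = -(27 * (p : ℤ) ^ 4) → ‖∑ j ∈ Finset.Icc 1 ((p - 1) / 3), (if (j : ZMod p) ^ ((p - 1) / 3) = 1 then (1 : ℂ) else if (j : ZMod p) ^ ((p - 1) / 3) = (r : ZMod p) then Complex.exp (2 * Real.pi * Complex.I / 3) else Complex.exp (2 * Real.pi * Complex.I / 3) ^ 2)‖ ^ 2 * (NumberField.classNumber K : ℝ) = (NumberField.classNumber F : ℝ)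

/-- item stmt-QuantumAdvantage-11650 · support · rank 9 · closed · proved by Summit.QuantumAdvantage.QuantumAdvantage.Theorems.PadLemma.padLemma_proof @ 6a5cbf762665 (prover) · by planner
sources: IrelandRosen1990, Washington1997
[support] PROVABLE NOW (arithmetic mod 3): an Eisenstein integer a + bω with 3 ∤ N(a+bω) is
determined by its associate class and its residue mod 3 (μ₆ → (ℤ[ω]/3)^× is a bijection) — the
card's pad lemma P5: given the ideal of S_p (class-group data), Kummer's sector and the factorial
trit t_p are classically inter-computable whenever 3 ∤ h⁻_p, so route KummerSector's KsThesis and X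
stand or fall together there; stated on the six explicit associates. [difficulty: provable-now] -/
@[route_item "route-QuantumAdvantage-ThirdFactorialPincer"]
def PadLemma : Prop :=
  ∀ a b c d : ℤ, ¬ ((3 : ℤ) ∣ a * a - a * b + b * b) → ((c = a ∧ d = b) ∨ (c = -b ∧ d = a - b) ∨ (c = b - a ∧ d = -a) ∨ (c = -a ∧ d = -b) ∨ (c = b ∧ d = b - a) ∨ (c = a - b ∧ d = a)) → (3 : ℤ) ∣ a - c → (3 : ℤ) ∣ b - d → c = a ∧ d = b

-- `PadLemma` holds: proved by `Summit.QuantumAdvantage.QuantumAdvantage.Theorems.PadLemma.padLemma_proof` @ 6a5cbf762665 (its module imports this route file, so no `_holds` link can be stated here).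

-- earlier GaussFactorialClassical (stmt-QuantumAdvantage-11651, replaced 2026-08-16T03:45:40Z -> stmt-QuantumAdvantage-14542): retired by None — ∃ A : Literature.Computability.Complexity.RandAlg (List Bool) (List Bool), Literature.Computability.Cryptography.IsPPT A id ∧ ∀ x : List Bool, (2 : ℝ) / 3 ≤ A.pr id x {List.ofFn (fun i : Fin x.length => (if (Computability.decodeNat x).Prime ∧ (Computability
/-- item stmt-QuantumAdvantage-14542 · support · rank 9 · open · by planner
sources: BostanGaudrySchost2007, CostaGerbiczHarvey2014, CosgraveDilcher2011, Tal2026ModularFactorials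
[support] ¬X, THE KILL (route-repair 2026-08-16: restated 1:1 with `IsPPT A id` unfolded to
`A.IsPolyTime id id`, Iff.rfl with the former stmt-QuantumAdvantage-11651): a PPT algorithm for the
third-factorial bit-function (equivalently, by DigitCongruence + JacobiCube + PadLemma, for the
counts of cubic residues in (0, p/3), or — given class groups — for Kummer's sector). Unranked so
that no prover seat is burnt; refuters push here: (a) literature — a printed polylog evaluation of
Γ_p(1/3) mod p or of Gauss factorials (CosgraveDilcher2011 are O(p)); (b) a classical algorithm for
BOTH h⁻ of the conductor-3p sextics with θ/θ̄ splitting AND the sector; (c) p-adic cohomology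
point-counting shortcuts (none apply). [difficulty: open-problem] -/
@[route_item "route-QuantumAdvantage-ThirdFactorialPincer"]
def GaussFactorialClassical : Prop :=
  ∃ A : Literature.Computability.Complexity.RandAlg (List Bool) (List Bool), A.IsPolyTime id id ∧ ∀ x : List Bool, (2 : ℝ) / 3 ≤ A.pr id x {List.ofFn (fun i : Fin x.length => (if (Computability.decodeNat x).Prime ∧ (Computability.decodeNat x % 9 = 4 ∨ Computability.decodeNat x % 9 = 7) then Nat.factorial ((Computability.decodeNat x - 1) / 3) % Computability.decodeNat x else 0).testBit i.val)}

-- earlier IdealLeg (stmt-QuantumAdvantage-11642, replaced 2026-08-16T04:39:12Z -> stmt-QuantumAdvantage-14639): retired by None — Literature.Computability.Cryptography.IsQSolvable fun x => {y | ∀ p r : ℕ, Computability.decodeNat x = p → p.Prime → p % 3 = 1 → r < p → (r * r + r + 1) % p = 0 → 2 * r + 1 < p → ∃ a b k : ℕ, b < a ∧ k < 6 ∧ (∑ j ∈ Finset.Icc 1 ((p - 1) / 3), (if (j : ZMod p) ^ ((p - 1) /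
/-- item stmt-QuantumAdvantage-14639 · support · rank 9 · open · by planner
why it might fail: Unconditional generation of Cl(F_p), Cl(K_p) by random degree-one primes of norm ≤ p^C rests on TZ2019 Thm 1.4 + 'no Siegel zero of ζ_{F_p}' (product of Dirichlet L, only real character χ₋₃); then Mazur–Wiles must pin v_λ vs v_λ̄ of S_p at split ℓ (θ-parts, ℓ ∤ 6); a θ↔λ̄ slip outputs S̄_p.
sources: ThornerZaman2019 Thm 1.4, MazurWiles1984, BiasseSong2015, Hallgren2005, Washington1997 Thm 4.17
[support] the UNCONDITIONAL ideal leg (= the conclusion of crux IdealLegOfEscape verbatim: the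
unique (a, b), a > b ≥ 0, with S_p = (a+bω)ζ₆^k, written as the 2|x|+2 low bits of Nat.pair a b on
the first 2|x|+2 wires) — not on the deciding path; the target of card
linnik-lights-the-class-group-v2 (random large degree-one primes + Linnik counts generate Cl(F_p)
w.p. ≥ 2/3 with no hypothesis) or of a no-Siegel-zero hypothesis for the quadratic characters of
conductor dividing 12p (Stark's lemma: an exceptional zero of a class-group character of F_p
descends to ℚ(√−3), ℚ(√±p), ℚ(√∓3p)). Route-repair 2026-08-16
(refuter-rattack-stmt-QuantumAdvantage-14572: the `encodeNat v <+: y` output convention was void as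
an interface — encodeNat 0 = [] is a prefix of every read-out and encodeNat is not prefix-free): the
output is now written FIXED-WIDTH on the first wires, little-endian `List.ofFn (fun i : Fin w =>
v.testBit i.val) <+: y` — the convention the target f itself uses — with w = 7 for m < 72 and w =
2|x|+2 for Nat.pair a b (decodeNat x < 2^(|x|+1), a ≤ (2/√3)(p−1)/3 < p, b < a ⇒ pair a b < (a+1)² ≤
p² < 2^(2|x|+2); planner Sketch.lean rc 0), applied consistently to IdealLegOfEscape, Ar -/
@[route_item "route-QuantumAdvantage-ThirdFactorialPincer"]
def IdealLeg : Prop :=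
  Literature.Computability.Cryptography.IsQSolvable fun x => {y | ∀ p r : ℕ, Computability.decodeNat x = p → p.Prime → p % 3 = 1 → r < p → (r * r + r + 1) % p = 0 → 2 * r + 1 < p → ∃ a b k : ℕ, b < a ∧ k < 6 ∧ (∑ j ∈ Finset.Icc 1 ((p - 1) / 3), (if (j : ZMod p) ^ ((p - 1) / 3) = 1 then (1 : ℂ) else if (j : ZMod p) ^ ((p - 1) / 3) = (r : ZMod p) then Complex.exp (2 * Real.pi * Complex.I / 3) else Complex.exp (2 * Real.pi * Complex.I / 3) ^ 2)) = ((a : ℂ) + (b : ℂ) * Complex.exp (2 * Real.pi * Complex.I / 3)) * Complex.exp (Real.pi * Complex.I * (k : ℂ) / 3) ∧ List.ofFn (fun i : Fin (2 * x.length + 2) => (Nat.pair a b).testBit i.val) <+: y}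

/-- item stmt-QuantumAdvantage-11648 · support · rank 9 · open · by planner
sources: vanDamSeroussi2002, Watrous2009, BernsteinVazirani1997, IrelandRosen1990
[support] GLUE (infrastructure + the pincer's last inch): IdealLeg → ArgLeg → DigitCongruence →
JacobiCube → f ∈ FBQP. From (a, b) and m the unit k ∈ ℤ/6 is unique (consecutive candidates are 60°
apart, the estimate is within 28.6° + slack; S_p ≠ 0 because a > b ≥ 0); S_p = (a+bω)ζ₆^k exactly; t
from S_p mod 3; for p ≡ 4,7 (9) the three cube roots of (−1)^K/L (deterministic cube root since 3 ∥
p−1, times 1, r, r²) have distinct χ-values r^{·K}, pick the one with c^K ≡ r^t: c = ((p−1)/3)! mod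
p. Classical steps (AKS, r by coherent coins, Euclid in ℤ[ω], cube roots) folded into one uniform
family with the two quantum subroutines (BQP^BQP = BQP pattern of the Shor chain). [difficulty: L] -/
@[route_item "route-QuantumAdvantage-ThirdFactorialPincer"]
def ThirdFactorialGlue : Prop :=
  IdealLeg → ArgLeg → DigitCongruence → JacobiCube → (fun x : List Bool => List.ofFn (fun i : Fin x.length => (if (Computability.decodeNat x).Prime ∧ (Computability.decodeNat x % 9 = 4 ∨ Computability.decodeNat x % 9 = 7) then Nat.factorial ((Computability.decodeNat x - 1) / 3) % Computability.decodeNat x else 0).testBit i.val)) ∈ Literature.Computability.Cryptography.FBQP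

-- earlier Assembly (stmt-QuantumAdvantage-11652, replaced 2026-08-16T03:25:36Z -> stmt-QuantumAdvantage-14447): retired by None — GaussFactorialHard → ERHHyp → IdealLegOfERH → ArgLeg → DigitCongruence → JacobiCube → ThirdFactorialGlue → SearchToDecision → QuantumAdvantage
-- earlier Assembly (stmt-QuantumAdvantage-14447, replaced 2026-08-16T03:30:04Z -> stmt-QuantumAdvantage-14519): retired by None — GaussFactorialHard → IdealLeg → ArgLeg → DigitCongruence → JacobiCube → ThirdFactorialGlue → SearchToDecision → QuantumAdvantage
-- earlier Assembly (stmt-QuantumAdvantage-14519, replaced 2026-08-16T03:45:40Z -> stmt-QuantumAdvantage-14543): retired by None — GaussFactorialHard → ExtendedRiemannHypothesis → IdealLegOfERH → ArgLeg → DigitCongruence → JacobiCube → ThirdFactorialGlue → SearchToDecision → QuantumAdvantage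
-- earlier Assembly (stmt-QuantumAdvantage-14543, replaced 2026-08-16T03:57:24Z -> stmt-QuantumAdvantage-14571): retired by None — GaussFactorialHard → IdealLegOfEscape → ArgLeg → SexticEscapeCount → DegreeOnePrimesEscape → DigitCongruence → JacobiCube → ThirdFactorialGlue → BitwiseSearchToDecision → QuantumAdvantage
/-- item stmt-QuantumAdvantage-14571 · assembly · rank 1 · closed · proved by Summit.QuantumAdvantage.QuantumAdvantage.Theorems.ThirdFactorialPincer.Assembly_proof @ fdb754c778d4 (prover) · by planner
sources: BernsteinVazirani1997, Aaronson2010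
[assembly] GaussFactorialHard → IdealLegOfEscape → ArgLeg → SexticEscapeCount →
DegreeOnePrimesEscape → FactorialFromPincer → BitwiseSearchToDecision → QuantumAdvantage
(route-repair 2026-08-16: unconditional, crux-only chain; the deciding theorem `closes` over the
same seven items is what decides, D-0027 §2.1). -/
@[route_item "route-QuantumAdvantage-ThirdFactorialPincer"]
def Assembly : Prop :=
  GaussFactorialHard → IdealLegOfEscape → ArgLeg → SexticEscapeCount → DegreeOnePrimesEscape → FactorialFromPincer → BitwiseSearchToDecision → QuantumAdvantage

-- `Assembly` holds: proved by `Summit.QuantumAdvantage.QuantumAdvantage.Theorems.ThirdFactorialPincer.Assembly_proof` @ fdb754c778d4 (its module imports this route file, so no `_holds` link can be stated here).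

-- records of items no longer active in this route (dropped / restated):
-- earlier ERHHyp (stmt-QuantumAdvantage-11641, replaced 2026-08-15T18:41:12Z -> stmt-QuantumAdvantage-11736): retired by None — Literature.NumberTheory.LFunctions.ExtendedRiemannHypothesis
-- earlier IdealLegOfERH (stmt-QuantumAdvantage-11643, replaced 2026-08-15T18:44:56Z -> stmt-QuantumAdvantage-11857): retired by None — Literature.NumberTheory.LFunctions.ExtendedRiemannHypothesis → Literature.Computability.Cryptography.IsQSolvable fun x => {y | ∀ p r : ℕ, Computability.decodeNat x = p → p.Prime → p % 3 = 1 → r < p → (r * r + r + 1) % p = 0 → 2 * r + 1 < p → ∃ a b k : ℕ, b < a ∧ k < 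
-- earlier AllGaussFactorialsMemFBQP (stmt-QuantumAdvantage-11645, replaced 2026-08-15T18:49:13Z -> stmt-QuantumAdvantage-12072): retired by None — Literature.NumberTheory.LFunctions.ExtendedRiemannHypothesis → ∀ N : ℕ, 0 < N → (fun x : List Bool => List.ofFn (fun i : Fin x.length => (if (Computability.decodeNat x).Prime ∧ N ∣ Computability.decodeNat x - 1 ∧ Nat.Coprime ((Computability.decodeNat x - 

/-! D-0027 §2.1 — DECIDING THEOREM (planner-authored via `route open/edit --closes-file`; by planner-rbadge-QuantumAdvantage-ThirdFactorial-bb1808d5-0 2026-08-16T03:57:24Z):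
its hypotheses are this route's items and its conclusion the sub-problem Statement (glue_lint), and it elaborates with this file. -/

@[closes "route-QuantumAdvantage-ThirdFactorialPincer"] theorem closes (hX : GaussFactorialHard) (hI : IdealLegOfEscape) (hA : ArgLeg) (hE6 : SexticEscapeCount)
    (hE3 : DegreeOnePrimesEscape) (hF : FactorialFromPincer) (hS : BitwiseSearchToDecision) :
    _root_.QuantumAdvantage := by
  by_contra hQA
  apply hX
  have hsub : Literature.Computability.Cryptography.BQP ⊆ Literature.Computability.Complexity.BPP :=
    fun L hL => Classical.by_contradiction fun hL' =>
      hQA (show _root_.QuantumAdvantage from ⟨L, hL, hL'⟩)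
  exact hS (fun x : List Bool => List.ofFn (fun i : Fin x.length =>
      (if (Computability.decodeNat x).Prime ∧ (Computability.decodeNat x % 9 = 4 ∨ Computability.decodeNat x % 9 = 7)
        then Nat.factorial ((Computability.decodeNat x - 1) / 3) % Computability.decodeNat x else 0).testBit i.val))
    ⟨Polynomial.X, fun x => by simp⟩ (hF (hI hE3 hE6) hA) hsub

end Summit.QuantumAdvantage.QuantumAdvantage.Theses.ThirdFactorialPincer
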